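import Literature.AnabelianGeometry.SemiGraphs.TemperedPiTreeCosetIso
import Literature.AnabelianGeometry.SemiGraphs.SubgroupPresentationArithLevels
import Literature.AnabelianGeometry.SemiGraphs.AutActionTransport
import HarnessLib

/-!
# The arithmetic actions on the trees of the Galois tower ([SemiAnbd] §5, Thm 5.4 p. 66)

Mochizuki, *Semi-graphs of anabelioids*, Publ. RIMS **42** (2006), §5: Def. 5.1 (i) p. 62, Prop. 5.2 (iv)
p. 64 (`1 → Π^temp_𝒢 → Π^temp_𝔊 → Π_A → 1`), p. 65 and the proof of Thm. 5.4 p. 66 ("entirely parallel"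
to Thm. 3.7: the arithmetic tempered group acts on the trees `𝒢_{∞,i}` of the Galois tower, covering the
arithmetic action on `𝔾`) [cite: MochizukiSemiAnbd2006, Thm 5.4, p. 66].

ASSEMBLY (cell row T54-B, tower third, file T3d-2; plan/GAP-LEDGER.md G-w4d053-1).  For abc-iut-L3-t9's
Galois tower `D` with compatible point sequences `T` and reference branches `R`, a group `E` acting on
`π₁^temp(𝒢)` by `Φ : E →* MulAut π₁^temp(𝒢)` and on `𝔾` by `σ`, compatibly with the presentation
`D.piPresentation T R` (`IsArithCompatible`, the cell's `ArithChart(Branch)Action` currency) and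
stabilising the tempered levels `ker ρ_n`, the ARITHMETIC ACTIONS ON THE TREES
`D.arithTreeAct … n : E →* Aut (D.tree n)` — the canonical action on the coset semi-graph
(`SubgroupPresentation.arithAct`) transported along `D.treeCosetIso T R n`.  PROVED: they COVER `σ`
through `D.treeProj n` (`arithTreeAct_comp_treeProj`, the `act_proj` field of the cell's `ArithLevelData`),
they EXTEND abc-iut-L3-t6's geometric action along the inner action (`arithTreeAct_inner`:
`arithTreeAct n (ι g) = D.treeAct n g`, the "`ρ j (ι n) = act j n`" clause), they COMMUTE WITH THE
TRANSITIONS `treeStep` (`arithTreeAct_treeStep`, the `trans_act` field), and their kernels are the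
kernels of the coset actions (`ker_arithTreeAct`, feeding the level kernels `levelKer` of
`SubgroupPresentationArithLevels.lean`).  Typed ≠ proved for [SemiAnbd] Thm 5.4 itself; nothing here
bears on [IUTchIII] Cor. 3.12.
-/

namespace Literature.AnabelianGeometry.SemiGraphs

namespace ProfiniteSemiGraph

namespace GaloisLevelData

open CategoryTheory

universe u v

variable {𝒢 : ProfiniteSemiGraph.{u}} (D : GaloisLevelData 𝒢) (h𝒢 : 𝒢.IsCountable)
  (T : ∀ w : 𝒢.graph.Vertex, D.PointSeq h𝒢 w) (R : SemiGraph.RefBranches 𝒢.graph)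
  {E : Type v} [Group E] {Φ : E →* MulAut (D.temperedPi h𝒢)} {σ : E →* Aut 𝒢.graph}
  (hP : (D.piPresentation h𝒢 T R).IsArithCompatible Φ σ)
  (hK : ∀ (n : ℕ) (e : E) (x : D.temperedPi h𝒢), x ∈ (D.projAut h𝒢 n).ker → Φ e x ∈ (D.projAut h𝒢 n).ker)

/-- **The arithmetic action of `E` on the tree `𝒢_{∞,n}`**: the canonical action on the coset semi-graph
of `π₁^temp(𝒢)` at the level `ker ρ_n`, transported along `treeCosetIso`.
[cite: MochizukiSemiAnbd2006, Thm 5.4, p. 66] -/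
noncomputable def arithTreeAct (n : ℕ) : E →* Aut (D.tree n) :=
  AutTransport.transportAct ((D.piPresentation h𝒢 T R).arithAct hP (D.projAut h𝒢 n).ker (hK n))
    (D.treeCosetIso h𝒢 T R n)

/-- The arithmetic action on the tree, on `hom`s. [cite: MochizukiSemiAnbd2006, Thm 5.4, p. 66] -/
theorem arithTreeAct_hom (n : ℕ) (e : E) :
    (D.arithTreeAct h𝒢 T R hP hK n e).hom = (D.treeCosetIso h𝒢 T R n).inv ≫
      ((D.piPresentation h𝒢 T R).arithAct hP (D.projAut h𝒢 n).ker (hK n) e).hom ≫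
        (D.treeCosetIso h𝒢 T R n).hom :=
  AutTransport.transportAct_hom _ _ e

/-- **The arithmetic action on `𝒢_{∞,n}` covers the action `σ` on `𝔾`** (the `act_proj` field of the
cell's `ArithLevelData`). [cite: MochizukiSemiAnbd2006, Thm 5.4, p. 66] -/
theorem arithTreeAct_comp_treeProj (n : ℕ) (e : E) :
    (D.arithTreeAct h𝒢 T R hP hK n e).hom ≫ D.treeProj n = D.treeProj n ≫ (σ e).hom :=
  AutTransport.transportAct_comp_proj _ _ ((D.piPresentation h𝒢 T R).cosetGraphProj _) (D.treeProj n)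
    (D.treeCosetIso_hom_comp_treeProj h𝒢 T R n) σ
    (fun e => (D.piPresentation h𝒢 T R).arithAct_comp_proj hP _ _ e) e

/-- **The arithmetic action EXTENDS the geometric action of `π₁^temp(𝒢)` on `𝒢_{∞,n}` along the inner
action**: for `ι : π₁^temp(𝒢) → E` with `Φ (ι g) = conj g` and `σ (ι g) = 1`,
`arithTreeAct n (ι g) = D.treeAct n g` (the "`ρ j (ι n) = act j n`" clause).
[cite: MochizukiSemiAnbd2006, Thm 5.4, p. 66] -/
theorem arithTreeAct_inner (n : ℕ) (ι : D.temperedPi h𝒢 →* E)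
    (hιΦ : ∀ g, Φ (ι g) = MulAut.conj g) (hισ : ∀ g, σ (ι g) = 1) (g : D.temperedPi h𝒢) :
    D.arithTreeAct h𝒢 T R hP hK n (ι g) = D.treeAct h𝒢 n g :=
  AutTransport.transportAct_eq_of_comp_eq _ _
    ((D.piPresentation h𝒢 T R).arithAct_eq_deckAct_of_inner hP _ _ (hιΦ g) (hισ g))
    (D.deckAct_comp_treeCosetIso h𝒢 T R n g)

/-- In particular the arithmetic action of `ι g` is over `𝔾` (abc-iut-L3-t6's `treeAct_over`).
[cite: MochizukiSemiAnbd2006, Thm 3.7(iii) p.41] -/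
theorem arithTreeAct_inner_over (n : ℕ) (ι : D.temperedPi h𝒢 →* E)
    (hιΦ : ∀ g, Φ (ι g) = MulAut.conj g) (hισ : ∀ g, σ (ι g) = 1) (g : D.temperedPi h𝒢) :
    (D.arithTreeAct h𝒢 T R hP hK n (ι g)).hom ≫ D.treeProj n = D.treeProj n := by
  rw [D.arithTreeAct_inner h𝒢 T R hP hK n ι hιΦ hισ g]
  exact D.treeAct_over h𝒢 n g

/-- **The arithmetic actions commute with the transitions of the trees** (the `trans_act` field of the
cell's `ArithLevelData`, for consecutive levels): `arithTreeAct (n+1) e ≫ treeStep n = treeStep n ≫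
arithTreeAct n e`. [cite: MochizukiSemiAnbd2006, Thm 5.4, p. 66] -/
theorem arithTreeAct_treeStep (n : ℕ) (e : E) :
    (D.arithTreeAct h𝒢 T R hP hK (n + 1) e).hom ≫ D.treeStep n =
      D.treeStep n ≫ (D.arithTreeAct h𝒢 T R hP hK n e).hom :=
  AutTransport.transportAct_comp_trans _ _ _ _ ((D.piPresentation h𝒢 T R).cosetGraphTrans
      (D.ker_projAut_succ_le h𝒢 n)) (D.treeStep n) (D.treeCosetIso_trans h𝒢 T R n)
    (fun e => (D.piPresentation h𝒢 T R).arithAct_trans hP (hK (n + 1)) (hK n)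
      (D.ker_projAut_succ_le h𝒢 n) e) e

/-- The kernel of the arithmetic action on `𝒢_{∞,n}` is the kernel of the coset action (so the level
kernels `levelKer` of `SubgroupPresentationArithLevels.lean` are read on the trees).
[cite: MochizukiSemiAnbd2006, Prop 5.2 (iv), p. 64] -/
theorem ker_arithTreeAct (n : ℕ) :
    (D.arithTreeAct h𝒢 T R hP hK n).ker =
      ((D.piPresentation h𝒢 T R).arithAct hP (D.projAut h𝒢 n).ker (hK n)).ker :=
  AutTransport.ker_transportAct _ _

/-- The level kernel at `ker ρ_n` consists of elements acting trivially on the tree `𝒢_{∞,n}`.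
[cite: MochizukiSemiAnbd2006, Prop 5.2 (iv), p. 64] -/
theorem arithTreeAct_eq_one_of_mem_levelKer (n : ℕ) {e : E}
    (he : e ∈ (D.piPresentation h𝒢 T R).levelKer hP (D.projAut h𝒢 n).ker (hK n)) :
    D.arithTreeAct h𝒢 T R hP hK n e = 1 := by
  rw [SemiGraph.SubgroupPresentation.mem_levelKer_iff] at he
  rw [← MonoidHom.mem_ker, D.ker_arithTreeAct h𝒢 T R hP hK n, MonoidHom.mem_ker]
  exact he.1

end GaloisLevelData

end ProfiniteSemiGraph

end Literature.AnabelianGeometry.SemiGraphs
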